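import Summits.QuantumFields.YangMills.Theorems.BalabanUVNodesK0Stub3V20RunSockets
import Summits.QuantumFields.YangMills.Theorems.BalabanUVNodesK0Stub3ComparabilityFace

/-!
# K0⁷ — STUB 3 UNDER THE V20 TEXTS, PART 4: the WEAKEST currency — the COMPARABILITY face 3ᶜ (`…K0Stub3ComparabilityFace` p609606: consecutive couplings of every in-window solution of
# (0.20) within a factor 2; NO β-value bound) — with the V20 antecedents (R ∕ G♭), its uniform ∕ token-free cores, the chains 3ᴿ-R ⟹ 3ᶜ-R and G♭ ⟹ R ⟹ V19, and K0⁷ BY NAME under the V20-R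
# stub-1 text and under V19's stub-1 text from ONE comparability letter per threshold

Cell `pub-ymgap`, width seat `pub-ymgap-k0-s3-w2` (g3; director-ym R399 (3a) ∕ №207; bus CLAIM-4 = this file).  `--kind proof --supports stmt-QuantumFields-20541 --as helper` (count-neutral).
NEW leaf; theorems only; 0 `def`; nothing modified; no registry write.  Imports `…K0Stub3V20RunSockets` (this seat, p633384 → p632040) and `…K0Stub3ComparabilityFace` (k0-s3-w2 g0, p609606).
[15] = [Balaban1985Variational]; [6] = [Balaban1985RegularSpaces]; [I] = [Balaban1987RG1]; [II] = [Balaban1989LargeFieldII]; [III] = [Balaban1988Convergent].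

WHY.  The K0 body consumes the β of record ONLY through the two history clauses (hcomp) ∧ (hcompRev) — 2-comparability of `cR·ε(g_m)`, `cR·ε(g_{m+1})` along the `γ`-windowed generated runs
([III] (2.4)–(2.8)); p609606 isolated the weakest letter that yields them, 3ᶜ: «on some level `γ₀ > 0`, every solution of (0.20) staying in `]0, γ₀]` has consecutive couplings within a factor 2»
(3ᴬ′ ⟹ 3ᴿ ⟹ 3ᶜ, neither converse).  Plan g86's WORD V20 = G (bus I.37134) re-letters the stub-3 antecedents; this file re-keys 3ᶜ to them exactly as `…V20Sockets` ∕ `…V20RunSockets` do for the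
box ∕ run letters: (§1) 3ᶜ-R ⟺ its uniform core ((j,c)-genericity free by `…CubeLetterBlind` §1); the token-free comparability core pays it; 3ᴿ-R ⟹ 3ᶜ-R (`exists_twoComparable_of_runConstRemainder`);
3ᶜ-G♭ ⟹ 3ᶜ-R ⟹ V19's 3ᶜ (weaker tokens = stronger socket); (§2) K0⁷'s body under the V20-R stub-1 TEXT from a floor-carrying (9)-supplier and 3ᶜ-R (p609606 §3 `clausesH_of_twoComparable` +
k0-s1-w3 g7's all-torus hcomp-closer at `h15R`, p630016), and K0⁷ BY NAME from {V20-R stub-1 text, stub 2′ BY NAME (p595104 through p630277's supplier), ONE of: 3ᶜ-R ∕ 3ᶜ-G♭ ∕ the token-free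
comparability core ∕ the token-free RUN core ∕ the token-free BOX core} and from V19's stub-1 text + 3ᶜ-R.

HONEST FRAMING.  By-name plumbing between typed socket SHAPES over landed letters; NO β estimate; nothing of Bałaban asserted; every [15] ∕ [6] ∕ [I] sentence is a HYPOTHESIS inhabited
nowhere; 3ᶜ (any text) remains NODE O's wall (a property of the couplings generated by the β of record on opaque integrals); ref-H NOTE-331b stands (3ᶜ is satisfied vacuously by a β expelling
every run at the first step — a discharge must display in-window runs of length ≥ 1; cf. p609916 `exists_inInterval_genSeq_of_runConstRemainder_zero` under 3ᴿ); no stub proved; K0⁷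
stmt-QuantumFields-20541 OPEN (V19 STANDS; V20-G is the plan's registration); counts unmoved (typed 28∕28 · discharged 5∕27, A 5∕28 — the chair's words).  One finite 𝕋⁴ programme at fixed
`ε = L^{−K}`, Bałaban AS PRINTED — NOT continuum ∕ ℝ⁴ ∕ OS ∕ mass gap ∕ Clay (the Yang–Mills mass gap is NOT proved by any of this; route R4 closes the CONDITIONAL finite-𝕋⁴ rung
`BalabanLadder.UV` only).  No `sorry`, `def`, `instance`, `notation`, `axiom`.
-/

noncomputable section

open scoped Matrix.Norms.L2Operator

namespace Summit.QuantumFields.YangMills.Theorems.K0Stub3V20ComparabilitySockets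

open Literature.MathematicalPhysics.QuantumFieldTheory.Balaban1983to89
open Literature.MathematicalPhysics.QuantumFieldTheory.Balaban1983to89.Node00
open Literature.MathematicalPhysics.QuantumFieldTheory.Balaban1983to89.T4Continuum
open Literature.MathematicalPhysics.QuantumFieldTheory.Balaban1983to89.FlowStep
open Summit.QuantumFields.YangMills.Theorems.BalabanUVNodesK2NamedJetsRunRemAt (RunConstRemainder)
open Summit.QuantumFields.YangMills.Theorems.K0V19Defs (Prop8StepCoPAt)
open Summit.QuantumFields.YangMills.Theorems.K0V19Stub2Prime (stub_prop6MemberB8AtP13)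
open Summit.QuantumFields.YangMills.Theorems.K0Stub3RunwiseFace (runConstRemainder_zero_of_absBox)
open Summit.QuantumFields.YangMills.Theorems.K0Stub3CubeLetterBlind (betaOfRecord₁₃_theta13OfThm1CCM_letterBlind)
open Summit.QuantumFields.YangMills.Theorems.K0Stub3ComparabilityFace (clausesH_of_twoComparable exists_twoComparable_of_runConstRemainder
  record13SepCoPHInhabited_of_stub1_comp3C_byName)
open Summit.QuantumFields.YangMills.BalabanUVNodes.N07Thm1Top7FromProp8 (variationalThm1RegSepCoP7MR_of_prop8TopStepR)
open Summit.QuantumFields.YangMills.Theorems.K0AllTorusOfStepTokensRFloor (exists_k0SepCoPH_thm1CCMW_of_thm1RegSepCoP7MR_of_gauge9TopStepR_of_hcomp_allTorus)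
open Summit.QuantumFields.YangMills.Theorems.K0PrintCubeOfStepTokensRFloor (gauge9SupplierR_of_prop6MemberP)
open Summit.QuantumFields.YangMills.Theorems.K0Stub3V20Sockets (tokensG_of_tokensR tokensR_of_tokensV19)

variable (F : T4Family)

/-! ## §1  The comparability face under the V20 antecedents: uniform ∕ token-free cores, runs ⟹ comparability, G♭ ⟹ R ⟹ V19 -/

section CompFace

/-- **★ 3ᶜ-R ⟺ ITS UNIFORM CORE** (p609606's text with the floor-carrying first antecedent `VariationalThm1RegSepCoP7MR F 2 c B₃ a₀ a₁`, same `c` as the (9)-antecedent): for every threshold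
`a₀ > 0` at which the R-tokens are inhabited, SOME `γ₀, ε₂₉ > 0` give the comparability letter for ALL `j, ε₀, B₃, B₃′, a₁` at once (one β by `…_letterBlind`, hence one set of runs).
A repackaging; nothing asserted. [cite: Balaban1987RG1, Thm 1 p.259, (0.20) p.256, (1.20)–(1.22) p.264, (2.9) p.266; Balaban1988Convergent, (2.4)–(2.8) pp.255–256; Balaban1985Variational, Thm 1 (8)–(9) p.279, p.304 lines 1–2] -/
theorem comp3CR_iff_uniformCompR :
    (∀ (j c : ℕ) (B₃ B₃' a₀ a₁ : ℝ), c ≤ F.L ^ j → 2 * (F.L : ℝ) ^ 2 ≤ B₃ → 0 < B₃' → 0 < a₀ → 0 < a₁ →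
      VariationalThm1RegSepCoP7MR F 2 c B₃ a₀ a₁ →
      Gauge9RegSepTopStepR F 2 (fun ν K Ω => suppDomOfRecord F ν K Ω) (F.L ^ j) c B₃ B₃' a₀ a₁ →
      ∃ γ₀ ε₀ ε₂₉ : ℝ, 0 < γ₀ ∧ 0 < ε₀ ∧ 0 < ε₂₉ ∧
        ∀ (n : ℕ) (gs : ℕ → ℝ), RGEqH n (betaOfRecord₁₃ F 2 (theta13OfThm1CCM F 2 j ε₀ ε₂₉ B₃ B₃' a₀ a₁)) gs → Step.InInterval γ₀ n gs →
          ∀ m, m < n → gs m ≤ 2 * gs (m + 1) ∧ gs (m + 1) ≤ 2 * gs m) ↔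
      ∀ a₀ : ℝ, 0 < a₀ →
        (∃ (j c : ℕ) (B₃ B₃' a₁ : ℝ), c ≤ F.L ^ j ∧ 2 * (F.L : ℝ) ^ 2 ≤ B₃ ∧ 0 < B₃' ∧ 0 < a₁ ∧
          VariationalThm1RegSepCoP7MR F 2 c B₃ a₀ a₁ ∧
          Gauge9RegSepTopStepR F 2 (fun ν K Ω => suppDomOfRecord F ν K Ω) (F.L ^ j) c B₃ B₃' a₀ a₁) →
        ∃ γ₀ ε₂₉ : ℝ, 0 < γ₀ ∧ 0 < ε₂₉ ∧ ∀ (j : ℕ) (ε₀ B₃ B₃' a₁ : ℝ),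
          ∀ (n : ℕ) (gs : ℕ → ℝ), RGEqH n (betaOfRecord₁₃ F 2 (theta13OfThm1CCM F 2 j ε₀ ε₂₉ B₃ B₃' a₀ a₁)) gs → Step.InInterval γ₀ n gs →
            ∀ m, m < n → gs m ≤ 2 * gs (m + 1) ∧ gs (m + 1) ≤ 2 * gs m := by
  constructor
  · rintro h a₀ ha₀ ⟨j, c, B₃, B₃', a₁, hc, hB₃, hB₃', ha₁, h15, h9⟩
    obtain ⟨γ₀, ε₀, ε₂₉, hγ₀, -, hε', hC⟩ := h j c B₃ B₃' a₀ a₁ hc hB₃ hB₃' ha₀ ha₁ h15 h9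
    refine ⟨γ₀, ε₂₉, hγ₀, hε', fun j' ε₀' C₃ C₃' c₁ => ?_⟩
    rw [betaOfRecord₁₃_theta13OfThm1CCM_letterBlind F 2 j' j ε₀' ε₀ ε₂₉ C₃ B₃ C₃' B₃' a₀ c₁ a₁]
    exact hC
  · intro h j c B₃ B₃' a₀ a₁ hc hB₃ hB₃' ha₀ ha₁ h15 h9
    obtain ⟨γ₀, ε₂₉, hγ₀, hε', hall⟩ := h a₀ ha₀ ⟨j, c, B₃, B₃', a₁, hc, hB₃, hB₃', ha₁, h15, h9⟩
    exact ⟨γ₀, 1, ε₂₉, hγ₀, one_pos, hε', hall j 1 B₃ B₃' a₁⟩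

/-- **THE TOKEN-FREE COMPARABILITY CORE PAYS 3ᶜ-R**: ONE comparability letter of the family `β₁₃(F; a₀, ε₂₉)` per threshold `a₀ > 0`.  CONDITIONAL; nothing asserted.
[cite: Balaban1987RG1, Thm 1 p.259, (0.20) p.256; Balaban1988Convergent, (2.4)–(2.8) pp.255–256; Balaban1985Variational, Thm 1 (8)–(9) p.279, p.304 lines 1–2; Balaban1989LargeFieldII, p.355] -/
theorem comp3CR_of_tokenFreeComp
    (h : ∀ a₀ : ℝ, 0 < a₀ → ∃ γ₀ ε₂₉ : ℝ, 0 < γ₀ ∧ 0 < ε₂₉ ∧ ∀ (j : ℕ) (ε₀ B₃ B₃' a₁ : ℝ),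
      ∀ (n : ℕ) (gs : ℕ → ℝ), RGEqH n (betaOfRecord₁₃ F 2 (theta13OfThm1CCM F 2 j ε₀ ε₂₉ B₃ B₃' a₀ a₁)) gs → Step.InInterval γ₀ n gs →
        ∀ m, m < n → gs m ≤ 2 * gs (m + 1) ∧ gs (m + 1) ≤ 2 * gs m) :
    ∀ (j c : ℕ) (B₃ B₃' a₀ a₁ : ℝ), c ≤ F.L ^ j → 2 * (F.L : ℝ) ^ 2 ≤ B₃ → 0 < B₃' → 0 < a₀ → 0 < a₁ →
      VariationalThm1RegSepCoP7MR F 2 c B₃ a₀ a₁ →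
      Gauge9RegSepTopStepR F 2 (fun ν K Ω => suppDomOfRecord F ν K Ω) (F.L ^ j) c B₃ B₃' a₀ a₁ →
      ∃ γ₀ ε₀ ε₂₉ : ℝ, 0 < γ₀ ∧ 0 < ε₀ ∧ 0 < ε₂₉ ∧
        ∀ (n : ℕ) (gs : ℕ → ℝ), RGEqH n (betaOfRecord₁₃ F 2 (theta13OfThm1CCM F 2 j ε₀ ε₂₉ B₃ B₃' a₀ a₁)) gs → Step.InInterval γ₀ n gs →
          ∀ m, m < n → gs m ≤ 2 * gs (m + 1) ∧ gs (m + 1) ≤ 2 * gs m :=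
  (comp3CR_iff_uniformCompR F).mpr fun a₀ ha₀ _ => h a₀ ha₀

/-- **THE TOKEN-FREE RUN CORE PAYS THE TOKEN-FREE COMPARABILITY CORE** (`exists_twoComparable_of_runConstRemainder`: a run letter at level `γ₀` gives the comparability letter at a level
`γ ≤ min γ₀ ½`; same `ε₂₉`).  The converse is NOT claimed (`twoComparable_not_runConstRemainder_model`, p609606 §5). [cite: Balaban1987RG1, (0.20) p.256, Thm 3 p.264 (bookkeeping); Balaban1988Convergent, (2.6)–(2.8) pp.255–256] -/
theorem tokenFreeComp_of_tokenFreeRun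
    (h : ∀ a₀ : ℝ, 0 < a₀ → ∃ γ₀ ε₂₉ β' : ℝ, 0 < γ₀ ∧ 0 < ε₂₉ ∧ ∀ (j : ℕ) (ε₀ B₃ B₃' a₁ : ℝ),
      RunConstRemainder (betaOfRecord₁₃ F 2 (theta13OfThm1CCM F 2 j ε₀ ε₂₉ B₃ B₃' a₀ a₁)) (fun _ => 0) β' γ₀) :
    ∀ a₀ : ℝ, 0 < a₀ → ∃ γ₀ ε₂₉ : ℝ, 0 < γ₀ ∧ 0 < ε₂₉ ∧ ∀ (j : ℕ) (ε₀ B₃ B₃' a₁ : ℝ),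
      ∀ (n : ℕ) (gs : ℕ → ℝ), RGEqH n (betaOfRecord₁₃ F 2 (theta13OfThm1CCM F 2 j ε₀ ε₂₉ B₃ B₃' a₀ a₁)) gs → Step.InInterval γ₀ n gs →
        ∀ m, m < n → gs m ≤ 2 * gs (m + 1) ∧ gs (m + 1) ≤ 2 * gs m := by
  intro a₀ ha₀
  obtain ⟨γ₀, ε₂₉, β', hγ₀, hε', hall⟩ := h a₀ ha₀
  obtain ⟨γ, hγpos, -, -, hC⟩ := exists_twoComparable_of_runConstRemainder hγ₀ (hall 0 1 1 1 1)
  refine ⟨γ, ε₂₉, hγpos, hε', fun j ε₀ B₃ B₃' a₁ => ?_⟩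
  rw [betaOfRecord₁₃_theta13OfThm1CCM_letterBlind F 2 j 0 ε₀ 1 ε₂₉ B₃ 1 B₃' 1 a₀ a₁ 1]
  exact hC

/-- **THE TOKEN-FREE BOX CORE PAYS THE TOKEN-FREE COMPARABILITY CORE** (box ⟹ runs about zero ⟹ comparability).  CONDITIONAL.
[cite: Balaban1987RG1, §1 (1.22) p.264, Thm 3 p.264, (0.20) p.256 (bookkeeping); Balaban1988Convergent, (2.6)–(2.8) pp.255–256] -/
theorem tokenFreeComp_of_tokenFree
    (h : ∀ a₀ : ℝ, 0 < a₀ → ∃ γ₀ ε₂₉ β' : ℝ, 0 < γ₀ ∧ 0 < ε₂₉ ∧ ∀ (j : ℕ) (ε₀ B₃ B₃' a₁ : ℝ),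
      BetaLowerH (-β') γ₀ (betaOfRecord₁₃ F 2 (theta13OfThm1CCM F 2 j ε₀ ε₂₉ B₃ B₃' a₀ a₁)) ∧
      BetaUpperH β' γ₀ (betaOfRecord₁₃ F 2 (theta13OfThm1CCM F 2 j ε₀ ε₂₉ B₃ B₃' a₀ a₁))) :
    ∀ a₀ : ℝ, 0 < a₀ → ∃ γ₀ ε₂₉ : ℝ, 0 < γ₀ ∧ 0 < ε₂₉ ∧ ∀ (j : ℕ) (ε₀ B₃ B₃' a₁ : ℝ),
      ∀ (n : ℕ) (gs : ℕ → ℝ), RGEqH n (betaOfRecord₁₃ F 2 (theta13OfThm1CCM F 2 j ε₀ ε₂₉ B₃ B₃' a₀ a₁)) gs → Step.InInterval γ₀ n gs →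
        ∀ m, m < n → gs m ≤ 2 * gs (m + 1) ∧ gs (m + 1) ≤ 2 * gs m := by
  refine tokenFreeComp_of_tokenFreeRun F fun a₀ ha₀ => ?_
  obtain ⟨γ₀, ε₂₉, β', hγ₀, hε', hall⟩ := h a₀ ha₀
  exact ⟨γ₀, ε₂₉, β', hγ₀, hε', fun j ε₀ B₃ B₃' a₁ => runConstRemainder_zero_of_absBox (hall j ε₀ B₃ B₃' a₁).1 (hall j ε₀ B₃ B₃' a₁).2⟩

/-- **3ᴿ-R ⟹ 3ᶜ-R AT ONE FAMILY** (p609606's `comp3C_of_run3R` with the R letter; the level drops to `γ ≤ min γ₀ ½`).  The converse is NOT claimed.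
[cite: Balaban1987RG1, (0.20) p.256, Thm 3 p.264, §1 p.264; Balaban1988Convergent, (2.6)–(2.8) pp.255–256; Balaban1985Variational, Thm 1 (8)–(9) p.279] -/
theorem comp3CR_of_run3RR
    (h : ∀ (j c : ℕ) (B₃ B₃' a₀ a₁ : ℝ), c ≤ F.L ^ j → 2 * (F.L : ℝ) ^ 2 ≤ B₃ → 0 < B₃' → 0 < a₀ → 0 < a₁ →
      VariationalThm1RegSepCoP7MR F 2 c B₃ a₀ a₁ →
      Gauge9RegSepTopStepR F 2 (fun ν K Ω => suppDomOfRecord F ν K Ω) (F.L ^ j) c B₃ B₃' a₀ a₁ →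
      ∃ γ₀ ε₀ ε₂₉ β' : ℝ, 0 < γ₀ ∧ 0 < ε₀ ∧ 0 < ε₂₉ ∧
        RunConstRemainder (betaOfRecord₁₃ F 2 (theta13OfThm1CCM F 2 j ε₀ ε₂₉ B₃ B₃' a₀ a₁)) (fun _ => 0) β' γ₀) :
    ∀ (j c : ℕ) (B₃ B₃' a₀ a₁ : ℝ), c ≤ F.L ^ j → 2 * (F.L : ℝ) ^ 2 ≤ B₃ → 0 < B₃' → 0 < a₀ → 0 < a₁ →
      VariationalThm1RegSepCoP7MR F 2 c B₃ a₀ a₁ →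
      Gauge9RegSepTopStepR F 2 (fun ν K Ω => suppDomOfRecord F ν K Ω) (F.L ^ j) c B₃ B₃' a₀ a₁ →
      ∃ γ₀ ε₀ ε₂₉ : ℝ, 0 < γ₀ ∧ 0 < ε₀ ∧ 0 < ε₂₉ ∧
        ∀ (n : ℕ) (gs : ℕ → ℝ), RGEqH n (betaOfRecord₁₃ F 2 (theta13OfThm1CCM F 2 j ε₀ ε₂₉ B₃ B₃' a₀ a₁)) gs → Step.InInterval γ₀ n gs →
          ∀ m, m < n → gs m ≤ 2 * gs (m + 1) ∧ gs (m + 1) ≤ 2 * gs m := by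
  intro j c B₃ B₃' a₀ a₁ hc hB₃ hB₃' ha₀ ha₁ h15 h9
  obtain ⟨γ₀, ε₀, ε₂₉, β', hγ0, hε, hε', hR⟩ := h j c B₃ B₃' a₀ a₁ hc hB₃ hB₃' ha₀ ha₁ h15 h9
  obtain ⟨γ, hγpos, -, -, hC⟩ := exists_twoComparable_of_runConstRemainder hγ0 hR
  exact ⟨γ, ε₀, ε₂₉, hγpos, hε, hε', hC⟩

/-- **3ᶜ-G♭ ⟹ 3ᶜ-R** (the comparability letter under the GUARDED antecedents `fun ν _M _g K k _s => c ≤ ν.M₁ ∧ k + c₀ ≤ F.m + K` with the level binder `c₀ ≤ j + 1` is the STRONGER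
socket: R-tokens are G-tokens at `c₀ := 0`; the binder-free G variant follows by ignoring the binder).  CONDITIONAL.
[cite: Balaban1987RG1, (0.20) p.256, §1 p.264, (0.1) p.251; Balaban1985Variational, Thm 1 (8)–(9) p.279, p.304 lines 1–2 (bookkeeping)] -/
theorem comp3CR_of_comp3CGb
    (h : ∀ (j c c₀ : ℕ) (B₃ B₃' a₀ a₁ : ℝ), c ≤ F.L ^ j → c₀ ≤ j + 1 → 2 * (F.L : ℝ) ^ 2 ≤ B₃ → 0 < B₃' → 0 < a₀ → 0 < a₁ →
      VariationalThm1RegSepCoP7MG F 2 (fun ν _M _g K k _s => c ≤ ν.M₁ ∧ k + c₀ ≤ F.m + K) B₃ a₀ a₁ →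
      Gauge9RegSepTopStepG F 2 (fun ν K Ω => suppDomOfRecord F ν K Ω) (F.L ^ j) (fun ν _M _g K k _s => c ≤ ν.M₁ ∧ k + c₀ ≤ F.m + K) B₃ B₃' a₀ a₁ →
      ∃ γ₀ ε₀ ε₂₉ : ℝ, 0 < γ₀ ∧ 0 < ε₀ ∧ 0 < ε₂₉ ∧
        ∀ (n : ℕ) (gs : ℕ → ℝ), RGEqH n (betaOfRecord₁₃ F 2 (theta13OfThm1CCM F 2 j ε₀ ε₂₉ B₃ B₃' a₀ a₁)) gs → Step.InInterval γ₀ n gs →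
          ∀ m, m < n → gs m ≤ 2 * gs (m + 1) ∧ gs (m + 1) ≤ 2 * gs m) :
    ∀ (j c : ℕ) (B₃ B₃' a₀ a₁ : ℝ), c ≤ F.L ^ j → 2 * (F.L : ℝ) ^ 2 ≤ B₃ → 0 < B₃' → 0 < a₀ → 0 < a₁ →
      VariationalThm1RegSepCoP7MR F 2 c B₃ a₀ a₁ →
      Gauge9RegSepTopStepR F 2 (fun ν K Ω => suppDomOfRecord F ν K Ω) (F.L ^ j) c B₃ B₃' a₀ a₁ →
      ∃ γ₀ ε₀ ε₂₉ : ℝ, 0 < γ₀ ∧ 0 < ε₀ ∧ 0 < ε₂₉ ∧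
        ∀ (n : ℕ) (gs : ℕ → ℝ), RGEqH n (betaOfRecord₁₃ F 2 (theta13OfThm1CCM F 2 j ε₀ ε₂₉ B₃ B₃' a₀ a₁)) gs → Step.InInterval γ₀ n gs →
          ∀ m, m < n → gs m ≤ 2 * gs (m + 1) ∧ gs (m + 1) ≤ 2 * gs m := by
  intro j c B₃ B₃' a₀ a₁ hc hB hB' ha₀ ha₁ h15 h9
  obtain ⟨h15G, h9G⟩ := tokensG_of_tokensR F 0 h15 h9
  exact h j c 0 B₃ B₃' a₀ a₁ hc (Nat.zero_le _) hB hB' ha₀ ha₁ h15G h9G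

/-- **3ᶜ-R ⟹ V19's 3ᶜ** (p609606's text with V19's floor-free first antecedent): V19-tokens are R-tokens at the same `c`.  So p609606's `record13SepCoPHInhabited_of_stub1_comp3C_byName` stays available
to an R-comparability supplier (§2's last theorem).  CONDITIONAL. [cite: Balaban1987RG1, (0.20) p.256 (bookkeeping); Balaban1985Variational, Thm 1 (8)–(9) p.279] -/
theorem comp3CV19_of_comp3CR
    (h : ∀ (j c : ℕ) (B₃ B₃' a₀ a₁ : ℝ), c ≤ F.L ^ j → 2 * (F.L : ℝ) ^ 2 ≤ B₃ → 0 < B₃' → 0 < a₀ → 0 < a₁ →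
      VariationalThm1RegSepCoP7MR F 2 c B₃ a₀ a₁ →
      Gauge9RegSepTopStepR F 2 (fun ν K Ω => suppDomOfRecord F ν K Ω) (F.L ^ j) c B₃ B₃' a₀ a₁ →
      ∃ γ₀ ε₀ ε₂₉ : ℝ, 0 < γ₀ ∧ 0 < ε₀ ∧ 0 < ε₂₉ ∧
        ∀ (n : ℕ) (gs : ℕ → ℝ), RGEqH n (betaOfRecord₁₃ F 2 (theta13OfThm1CCM F 2 j ε₀ ε₂₉ B₃ B₃' a₀ a₁)) gs → Step.InInterval γ₀ n gs →
          ∀ m, m < n → gs m ≤ 2 * gs (m + 1) ∧ gs (m + 1) ≤ 2 * gs m) :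
    ∀ (j c : ℕ) (B₃ B₃' a₀ a₁ : ℝ), c ≤ F.L ^ j → 2 * (F.L : ℝ) ^ 2 ≤ B₃ → 0 < B₃' → 0 < a₀ → 0 < a₁ →
      VariationalThm1RegSepCoP7M F 2 B₃ a₀ a₁ →
      Gauge9RegSepTopStepR F 2 (fun ν K Ω => suppDomOfRecord F ν K Ω) (F.L ^ j) c B₃ B₃' a₀ a₁ →
      ∃ γ₀ ε₀ ε₂₉ : ℝ, 0 < γ₀ ∧ 0 < ε₀ ∧ 0 < ε₂₉ ∧
        ∀ (n : ℕ) (gs : ℕ → ℝ), RGEqH n (betaOfRecord₁₃ F 2 (theta13OfThm1CCM F 2 j ε₀ ε₂₉ B₃ B₃' a₀ a₁)) gs → Step.InInterval γ₀ n gs →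
          ∀ m, m < n → gs m ≤ 2 * gs (m + 1) ∧ gs (m + 1) ≤ 2 * gs m :=
  fun j c B₃ B₃' a₀ a₁ hc hB hB' ha₀ ha₁ h15 h9 => h j c B₃ B₃' a₀ a₁ hc hB hB' ha₀ ha₁ (tokensR_of_tokensV19 F h15 h9).1 h9

end CompFace

/-! ## §2  K0⁷ under the V20-R stub-1 TEXT from ONE comparability letter: the body at `(L^j, c)`, the generic-supplier composition, K0⁷ BY NAME (stub 2′ by name, p595104); and under V19's stub 1 -/

section ByName

variable {F}

/-- **★ THE ⁷ K0 BODY FOR `F` AT AN ARBITRARY CUBE LETTER `(L^j, c)`, `c ≤ L^j`, FROM THE FLOOR-CARRYING (8) AT FLOOR `c`, THE (9)-TOKEN AT `(L^j, c)` AND ONE COMPARABILITY LETTER OF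
`θ₁₅ᶜᶜᴹ(j)`** — p609606 §3's `exists_k0H_of_thm1CoP7M_of_gauge9R_of_twoComparable` at `h15R`: `clausesH_of_twoComparable` (token-free, NO β-value read) gives (hcomp) ∧ (hcompRev) at
`θ₁₅ᶜᶜᴹᵂ(j; γ)`, then k0-s1-w3 g7's all-torus closer (p630016).  CONDITIONAL.
[cite: Balaban1985Variational, Thm 1 (8)–(9) p.279, (144)–(152) pp.300–301, Prop. 8 p.304, p.304 lines 1–2; Balaban1988Convergent, Thm 1 p.262, (2.4)–(2.8) pp.255–256, p.257, (2.21) p.258; Balaban1987RG1, Thm 1 p.259, (1.12) p.262, (0.20) p.256] -/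
theorem exists_k0H_of_thm1CoP7MR_of_gauge9R_of_twoComparable (F : T4Family) {j c : ℕ} (hc : c ≤ F.L ^ j) {B₃ B₉ a₀ a₁ : ℝ} (hB₃ : 0 ≤ B₃) (hB₉ : 0 ≤ B₉)
    (ha₀ : 0 < a₀) (ha₁ : 0 < a₁) (h15 : VariationalThm1RegSepCoP7MR F 2 c B₃ a₀ a₁)
    (h9 : Gauge9RegSepTopStepR F 2 (fun ν K Ω => suppDomOfRecord F ν K Ω) (F.L ^ j) c B₃ B₉ a₀ a₁)
    (h3C : ∃ γ₀ ε₀ ε₂₉ : ℝ, 0 < γ₀ ∧ 0 < ε₀ ∧ 0 < ε₂₉ ∧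
        ∀ (n : ℕ) (gs : ℕ → ℝ), RGEqH n (betaOfRecord₁₃ F 2 (theta13OfThm1CCM F 2 j ε₀ ε₂₉ B₃ B₉ a₀ a₁)) gs → Step.InInterval γ₀ n gs →
          ∀ m, m < n → gs m ≤ 2 * gs (m + 1) ∧ gs (m + 1) ≤ 2 * gs m) :
    ∃ θ : Stage13HParams F 2, θ.Provisos₁₃SepCoPH F 2 ∧ (θ.ZhUnity F 2 ∧ θ.SlotsNondegenerate₁₃ F 2) ∧ θ.Admissible F 2 := by
  obtain ⟨γ, ε₀, ε₂₉, hγ0, hγ, hε, hε', hcomp, hcompRev⟩ := clausesH_of_twoComparable F j hB₃ hB₉ ha₀.le ha₁.le h3C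
  exact exists_k0SepCoPH_thm1CCMW_of_thm1RegSepCoP7MR_of_gauge9TopStepR_of_hcomp_allTorus F hγ0 hγ hε hε' hB₃ hB₉ ha₀ ha₁ h15 hc h9 hcomp hcompRev

/-- **★★ K0⁷'s BODY AT EVERY FAMILY FROM V20-R's STUB 1, A GENERIC FLOOR-CARRYING (9)-SUPPLIER, AND 3ᶜ-R** (`…V20RunSockets.record13SepCoPHBody_of_stub1R_of_gauge9SupplierR_of_run3RR` with the run
letter replaced by the comparability letter; p609606 §4's pattern).  CONDITIONAL; K0⁷ NOT closed here; nothing of Bałaban asserted.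
[cite: Balaban1985Variational, Thm 1 (8)–(9) p.279, (144)–(152) pp.300–301, Prop. 8 p.304, p.304 lines 1–2; Balaban1985RegularSpaces, (1.3)–(1.6) p.77, Prop. 6 p.99, p.98; Balaban1988Convergent, Thm 1 p.262, (2.4)–(2.8) pp.255–256; Balaban1987RG1, Thm 1 p.259, (0.20) p.256] -/
theorem record13SepCoPHBody_of_stub1R_of_gauge9SupplierR_of_comp3CR
    (h1R : ∀ F : T4Family, ∃ (c : ℕ) (B₃ a₀ a₁ : ℝ), 2 * (F.L : ℝ) ^ 2 ≤ B₃ ∧ 0 < a₀ ∧ 0 < a₁ ∧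
      Prop8RegSepTopStepR F 2 (fun ν K Ω => suppDomOfRecord F ν K Ω) c B₃ a₀ a₁)
    (hSR : ∀ (F : T4Family) (c : ℕ) (B₃ a₀ a₁ : ℝ), 2 * (F.L : ℝ) ^ 2 ≤ B₃ → 0 < a₀ → 0 < a₁ →
      Prop8RegSepTopStepR F 2 (fun ν K Ω => suppDomOfRecord F ν K Ω) c B₃ a₀ a₁ →
      ∃ (j c' : ℕ) (B₉ a₁' : ℝ), c ≤ c' ∧ c' ≤ F.L ^ j ∧ 0 < B₉ ∧ 0 < a₁' ∧ a₁' ≤ a₁ ∧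
        Gauge9RegSepTopStepR F 2 (fun ν K Ω => suppDomOfRecord F ν K Ω) (F.L ^ j) c' B₃ B₉ a₀ a₁')
    (h3CR : ∀ (F : T4Family) (j c : ℕ) (B₃ B₃' a₀ a₁ : ℝ), c ≤ F.L ^ j → 2 * (F.L : ℝ) ^ 2 ≤ B₃ → 0 < B₃' → 0 < a₀ → 0 < a₁ →
      VariationalThm1RegSepCoP7MR F 2 c B₃ a₀ a₁ →
      Gauge9RegSepTopStepR F 2 (fun ν K Ω => suppDomOfRecord F ν K Ω) (F.L ^ j) c B₃ B₃' a₀ a₁ →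
      ∃ γ₀ ε₀ ε₂₉ : ℝ, 0 < γ₀ ∧ 0 < ε₀ ∧ 0 < ε₂₉ ∧
        ∀ (n : ℕ) (gs : ℕ → ℝ), RGEqH n (betaOfRecord₁₃ F 2 (theta13OfThm1CCM F 2 j ε₀ ε₂₉ B₃ B₃' a₀ a₁)) gs → Step.InInterval γ₀ n gs →
          ∀ m, m < n → gs m ≤ 2 * gs (m + 1) ∧ gs (m + 1) ≤ 2 * gs m) :
    ∀ F : T4Family, ∃ θ : Stage13HParams F 2, θ.Provisos₁₃SepCoPH F 2 ∧ (θ.ZhUnity F 2 ∧ θ.SlotsNondegenerate₁₃ F 2) ∧ θ.Admissible F 2 := by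
  intro F
  obtain ⟨c, B₃, a₀, a₁, hB₃, ha₀, ha₁, h8⟩ := h1R F
  have hL : (0 : ℝ) < (F.L : ℝ) := by exact_mod_cast lt_trans Nat.zero_lt_one F.hL.2
  have hBpos : (0 : ℝ) < B₃ := lt_of_lt_of_le (mul_pos two_pos (pow_pos hL 2)) hB₃
  obtain ⟨j, c', B₉, a₁', hcc', hc', hB₉, ha₁', ha₁'le, h9⟩ := hSR F c B₃ a₀ a₁ hB₃ ha₀ ha₁ h8
  have h15 : VariationalThm1RegSepCoP7MR F 2 c' B₃ a₀ a₁' :=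
    variationalThm1RegSepCoP7MR_of_prop8TopStepR hBpos ((h8.of_le le_rfl ha₁'le).mono_floor hcc')
  exact exists_k0H_of_thm1CoP7MR_of_gauge9R_of_twoComparable F hc' hBpos.le hB₉.le ha₀ ha₁' h15 h9 (h3CR F j c' B₃ B₉ a₀ a₁' hc' hB₃ hB₉ ha₀ ha₁' h15 h9)

/-- **★★★ K0⁷ BY NAME FROM THE V20-R STUB-1 TEXT AND 3ᶜ-R** — stub 2′ DISCHARGED BY NAME (`K0V19Stub2Prime.stub_prop6MemberB8AtP13`, p595104) through k0-s1-w3 g7's print-cube R-supplier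
`gauge9SupplierR_of_prop6MemberP` (p630277).  On this road the open K0⁷ bill reads {V20's stub 1, ONE comparability letter of `β₁₃(F; a₀, ε₂₉)` per admissible threshold (NODE O; no β-value
bound asked)}.  CONDITIONAL on both texts (displayed, NOT inhabited here); K0⁷ OPEN; a helper, not a closer.
[cite: Balaban1985Variational, Thm 1 (8)–(9) p.279, (144)–(152) pp.300–301, Prop. 8 p.304, p.304 lines 1–2; Balaban1985RegularSpaces, Prop. 6 p.99, p.98; Balaban1988Convergent, Thm 1 p.262, (2.4)–(2.8) pp.255–256; Balaban1987RG1, Thm 1 p.259, (0.20) p.256; Balaban1989LargeFieldII, p.355] -/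
theorem record13SepCoPHInhabited_of_stub1R_comp3CR_byName
    (h1R : ∀ F : T4Family, ∃ (c : ℕ) (B₃ a₀ a₁ : ℝ), 2 * (F.L : ℝ) ^ 2 ≤ B₃ ∧ 0 < a₀ ∧ 0 < a₁ ∧
      Prop8RegSepTopStepR F 2 (fun ν K Ω => suppDomOfRecord F ν K Ω) c B₃ a₀ a₁)
    (h3CR : ∀ (F : T4Family) (j c : ℕ) (B₃ B₃' a₀ a₁ : ℝ), c ≤ F.L ^ j → 2 * (F.L : ℝ) ^ 2 ≤ B₃ → 0 < B₃' → 0 < a₀ → 0 < a₁ →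
      VariationalThm1RegSepCoP7MR F 2 c B₃ a₀ a₁ →
      Gauge9RegSepTopStepR F 2 (fun ν K Ω => suppDomOfRecord F ν K Ω) (F.L ^ j) c B₃ B₃' a₀ a₁ →
      ∃ γ₀ ε₀ ε₂₉ : ℝ, 0 < γ₀ ∧ 0 < ε₀ ∧ 0 < ε₂₉ ∧
        ∀ (n : ℕ) (gs : ℕ → ℝ), RGEqH n (betaOfRecord₁₃ F 2 (theta13OfThm1CCM F 2 j ε₀ ε₂₉ B₃ B₃' a₀ a₁)) gs → Step.InInterval γ₀ n gs →
          ∀ m, m < n → gs m ≤ 2 * gs (m + 1) ∧ gs (m + 1) ≤ 2 * gs m) :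
    Summit.QuantumFields.YangMills.Theses.BalabanUVNodes.Record13SepCoPHInhabited :=
  record13SepCoPHBody_of_stub1R_of_gauge9SupplierR_of_comp3CR h1R
    (fun F c B₃ a₀ a₁ hB₃ ha₀ ha₁ h8 => gauge9SupplierR_of_prop6MemberP F (stub_prop6MemberB8AtP13 F) c B₃ a₀ a₁ hB₃ ha₀ ha₁ h8) h3CR

/-- **★★ K0⁷ BY NAME FROM THE V20-R STUB-1 TEXT AND 3ᶜ-G♭** (§1's `comp3CR_of_comp3CGb`).  CONDITIONAL on both texts; K0⁷ OPEN; a helper, not a closer.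
[cite: Balaban1985Variational, Thm 1 (8)–(9) p.279, Prop. 8 p.304, p.304 lines 1–2; Balaban1985RegularSpaces, Prop. 6 p.99; Balaban1988Convergent, Thm 1 p.262, (2.4)–(2.8) pp.255–256; Balaban1987RG1, Thm 1 p.259, (0.20) p.256, (0.1) p.251] -/
theorem record13SepCoPHInhabited_of_stub1R_comp3CGb_byName
    (h1R : ∀ F : T4Family, ∃ (c : ℕ) (B₃ a₀ a₁ : ℝ), 2 * (F.L : ℝ) ^ 2 ≤ B₃ ∧ 0 < a₀ ∧ 0 < a₁ ∧
      Prop8RegSepTopStepR F 2 (fun ν K Ω => suppDomOfRecord F ν K Ω) c B₃ a₀ a₁)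
    (h3CGb : ∀ (F : T4Family) (j c c₀ : ℕ) (B₃ B₃' a₀ a₁ : ℝ), c ≤ F.L ^ j → c₀ ≤ j + 1 → 2 * (F.L : ℝ) ^ 2 ≤ B₃ → 0 < B₃' → 0 < a₀ → 0 < a₁ →
      VariationalThm1RegSepCoP7MG F 2 (fun ν _M _g K k _s => c ≤ ν.M₁ ∧ k + c₀ ≤ F.m + K) B₃ a₀ a₁ →
      Gauge9RegSepTopStepG F 2 (fun ν K Ω => suppDomOfRecord F ν K Ω) (F.L ^ j) (fun ν _M _g K k _s => c ≤ ν.M₁ ∧ k + c₀ ≤ F.m + K) B₃ B₃' a₀ a₁ →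
      ∃ γ₀ ε₀ ε₂₉ : ℝ, 0 < γ₀ ∧ 0 < ε₀ ∧ 0 < ε₂₉ ∧
        ∀ (n : ℕ) (gs : ℕ → ℝ), RGEqH n (betaOfRecord₁₃ F 2 (theta13OfThm1CCM F 2 j ε₀ ε₂₉ B₃ B₃' a₀ a₁)) gs → Step.InInterval γ₀ n gs →
          ∀ m, m < n → gs m ≤ 2 * gs (m + 1) ∧ gs (m + 1) ≤ 2 * gs m) :
    Summit.QuantumFields.YangMills.Theses.BalabanUVNodes.Record13SepCoPHInhabited :=
  record13SepCoPHInhabited_of_stub1R_comp3CR_byName h1R fun F => comp3CR_of_comp3CGb F (h3CGb F)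

/-- **★★★ K0⁷ BY NAME FROM THE V20-R STUB-1 TEXT AND THE TOKEN-FREE COMPARABILITY CORE** (ONE comparability letter of `β₁₃(F; a₀, ε₂₉)` per threshold — the weakest text-independent
K0 β-bill).  CONDITIONAL; K0⁷ OPEN; a helper, not a closer. [cite: Balaban1985Variational, Thm 1 (8)–(9) p.279, Prop. 8 p.304, p.304 lines 1–2; Balaban1985RegularSpaces, Prop. 6 p.99; Balaban1988Convergent, Thm 1 p.262, (2.4)–(2.8) pp.255–256; Balaban1987RG1, Thm 1 p.259, (0.20) p.256; Balaban1989LargeFieldII, p.355] -/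
theorem record13SepCoPHInhabited_of_stub1R_tokenFreeComp_byName
    (h1R : ∀ F : T4Family, ∃ (c : ℕ) (B₃ a₀ a₁ : ℝ), 2 * (F.L : ℝ) ^ 2 ≤ B₃ ∧ 0 < a₀ ∧ 0 < a₁ ∧
      Prop8RegSepTopStepR F 2 (fun ν K Ω => suppDomOfRecord F ν K Ω) c B₃ a₀ a₁)
    (hT : ∀ (F : T4Family) (a₀ : ℝ), 0 < a₀ → ∃ γ₀ ε₂₉ : ℝ, 0 < γ₀ ∧ 0 < ε₂₉ ∧ ∀ (j : ℕ) (ε₀ B₃ B₃' a₁ : ℝ),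
      ∀ (n : ℕ) (gs : ℕ → ℝ), RGEqH n (betaOfRecord₁₃ F 2 (theta13OfThm1CCM F 2 j ε₀ ε₂₉ B₃ B₃' a₀ a₁)) gs → Step.InInterval γ₀ n gs →
        ∀ m, m < n → gs m ≤ 2 * gs (m + 1) ∧ gs (m + 1) ≤ 2 * gs m) :
    Summit.QuantumFields.YangMills.Theses.BalabanUVNodes.Record13SepCoPHInhabited :=
  record13SepCoPHInhabited_of_stub1R_comp3CR_byName h1R fun F => comp3CR_of_tokenFreeComp F (hT F)

/-- **K0⁷ BY NAME FROM V19's REGISTERED STUB-1 TEXT AND 3ᶜ-R** (§1's `comp3CV19_of_comp3CR`, then p609606's `record13SepCoPHInhabited_of_stub1_comp3C_byName`): while V19 STANDS, a by-name proof of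
`stub_prop8StepCoP13` together with the R-lettered comparability face closes K0⁷ through this line.  CONDITIONAL on both texts; K0⁷ OPEN; a helper, not a closer.
[cite: Balaban1985Variational, Thm 1 (8)–(9) p.279, Prop. 8 p.304; Balaban1985RegularSpaces, Prop. 6 p.99; Balaban1988Convergent, Thm 1 p.262, (2.4)–(2.8) pp.255–256; Balaban1987RG1, Thm 1 p.259, (0.20) p.256] -/
theorem record13SepCoPHInhabited_of_stub1_comp3CR_byName (h1 : ∀ F : T4Family, Prop8StepCoPAt F)
    (h3CR : ∀ (F : T4Family) (j c : ℕ) (B₃ B₃' a₀ a₁ : ℝ), c ≤ F.L ^ j → 2 * (F.L : ℝ) ^ 2 ≤ B₃ → 0 < B₃' → 0 < a₀ → 0 < a₁ →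
      VariationalThm1RegSepCoP7MR F 2 c B₃ a₀ a₁ →
      Gauge9RegSepTopStepR F 2 (fun ν K Ω => suppDomOfRecord F ν K Ω) (F.L ^ j) c B₃ B₃' a₀ a₁ →
      ∃ γ₀ ε₀ ε₂₉ : ℝ, 0 < γ₀ ∧ 0 < ε₀ ∧ 0 < ε₂₉ ∧
        ∀ (n : ℕ) (gs : ℕ → ℝ), RGEqH n (betaOfRecord₁₃ F 2 (theta13OfThm1CCM F 2 j ε₀ ε₂₉ B₃ B₃' a₀ a₁)) gs → Step.InInterval γ₀ n gs →
          ∀ m, m < n → gs m ≤ 2 * gs (m + 1) ∧ gs (m + 1) ≤ 2 * gs m) :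
    Summit.QuantumFields.YangMills.Theses.BalabanUVNodes.Record13SepCoPHInhabited :=
  record13SepCoPHInhabited_of_stub1_comp3C_byName h1 fun F => comp3CV19_of_comp3CR F (h3CR F)

end ByName

end Summit.QuantumFields.YangMills.Theorems.K0Stub3V20ComparabilitySockets

end
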